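import Summits.QuantumFields.YangMills.Theorems.ColdStartUniversalityLatticeLangevinNoiseFrameParseval
import Summits.QuantumFields.YangMills.Theorems.ColdStartUniversalityLatticeLangevinGeneratorSymmetric
import HarnessLib

/-!
# Route `ColdStartUniversality` (fixed-cut-off package): the ONE-LINK DICTIONARY — the carré du champ of the SZZ coordinate generator
# is `2 · Σ_e SUNBakryEmery.Gam` of the link-wise ambient extensions

Helper file (seat `ym-line-csu-p1`, g21; `--supports stmt-QuantumFields-27363`).  For the SU(2) SZZ dynamics on `(ℤ/L)³` (any `β'`; the
noise does not depend on `β'`), a cylinder observable `F = f∘coords` (`f` a function of the real link coordinates) and a configuration `V`: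

  `Γ(f,f)(V) := Σ_{ij} ∂_i f ∂_j f (σσᵀ)_{ij}(V) = 2 · Σ_e Gam(f ∘ ψ_e^V)(Q_e)`,   `Q_e = ρ(V_e) ∈ SU(2)`,

where `ψ_e^V(X)` is the coordinate vector of `V` with the block of link `e` replaced by the real coordinates of the MATRIX `X ∈ M_2(ℂ)`
(so `f ∘ ψ_e^V` is the ambient extension of `F` in the link `e`, the argument of the Bakry–Émery files `Literature…SUNBakryEmery*`), and
`Gam(u)(Q) = Σ_α (dF(Q)[QY_α])²` their carré du champ.  Ingredients: `Γ = Σ_{(e,m)} (df[σ_{e,m}])²` (finite-sum algebra),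
`σ_{e,m} = √2·𝐩(E_m)·Q_e` read through the affine map `ψ_e^V` (chain rule), and `sum_sq_apply_noise_eq_two_mul_sum_sq_apply_mul_frame`
(noise basis ↔ Parseval frame, left ↔ right invariance).  With the one-link LOG-SOBOLEV inequality for Haar (`logSobolev_haar_of_contDiff_one`,
g20) this is the per-link input of the tensorisation argument for the Haar^E log-Sobolev inequality in the CSU generator language
(not done here: needs the n-fold form of `EntropyFlow.entropy_prod_le`).

* `sum_sum_mul_mul_noiseCov_eq_sum_sq` — `Σ_{ij} a_i a_j Σ_n σ_in σ_jn = Σ_n (Σ_i a_i σ_in)²`;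
* `sum_fderiv_single_mul_eq_fderiv` — `Σ_i ∂_i f(c) w_i = df(c)[w]`;
* ★★ `carre_eq_two_mul_sum_Gam` — the dictionary.
THEOREMS ONLY, no definition, no sorry.  RECORD-rung R3 plumbing; nothing here bears on the Yang–Mills mass gap.
-/

set_option autoImplicit false

noncomputable section

namespace Summit.QuantumFields.YangMills.Theorems.ColdStartUniversality

open scoped Matrix ComplexConjugate BigOperators
open Matrix Complex Finset
open Literature.MathematicalPhysics.QuantumFieldTheory
open Literature.MathematicalPhysics.QuantumLattice (fundamentalRep fundamentalLatticeRep continuous_fundamentalRep)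

/-! ## §1. Finite-sum algebra and linearity of the differential -/

/-- `Σ_{ij} a_i a_j (Σ_n σ_in σ_jn) = Σ_n (Σ_i a_i σ_in)²`. [folklore] -/
theorem sum_sum_mul_mul_noiseCov_eq_sum_sq {ι κ : Type*} [Fintype ι] [Fintype κ] (a : ι → ℝ) (σ : ι → κ → ℝ) :
    ∑ i, ∑ j, a i * a j * ∑ n, σ i n * σ j n = ∑ n, (∑ i, a i * σ i n) ^ 2 := by
  calc ∑ i, ∑ j, a i * a j * ∑ n, σ i n * σ j n = ∑ i, ∑ j, ∑ n, (a i * σ i n) * (a j * σ j n) := by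
        refine sum_congr rfl fun i _ => sum_congr rfl fun j _ => ?_
        rw [mul_sum]; exact sum_congr rfl fun n _ => by ring
    _ = ∑ i, ∑ n, ∑ j, (a i * σ i n) * (a j * σ j n) := sum_congr rfl fun i _ => Finset.sum_comm
    _ = ∑ n, ∑ i, ∑ j, (a i * σ i n) * (a j * σ j n) := Finset.sum_comm
    _ = ∑ n, (∑ i, a i * σ i n) ^ 2 := by
        refine sum_congr rfl fun n _ => ?_
        rw [sq, sum_mul_sum]

/-- `Σ_i df(c)[e_i] w_i = df(c)[w]` for a continuous linear `D` (applied to `D = fderiv f c`). [folklore] -/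
theorem sum_apply_single_mul_eq_apply {ι : Type*} [Fintype ι] [DecidableEq ι] (D : (ι → ℝ) →L[ℝ] ℝ) (w : ι → ℝ) :
    ∑ i, D (Pi.single i 1) * w i = D w := by
  have hw : w = ∑ i, w i • (Pi.single i (1 : ℝ) : ι → ℝ) := by
    funext j
    simp only [Finset.sum_apply, Pi.smul_apply, Pi.single_apply, smul_eq_mul, mul_ite, mul_one, mul_zero,
      Finset.sum_ite_eq, Finset.mem_univ, if_true]
  conv_rhs => rw [hw]
  rw [map_sum]
  exact sum_congr rfl fun i _ => by rw [map_smul, smul_eq_mul, mul_comm]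

/-! ## §2. The dictionary -/

open scoped Matrix.Norms.Frobenius in
/-- ★★ **The one-link dictionary.**  For every differentiable `f` of the real link coordinates and every configuration `V`, the carré
du champ of the SZZ coordinate generator equals `2 Σ_e Gam(f ∘ ψ_e^V)(ρ(V_e))`, `ψ_e^V(X) =` the coordinates of `V` with the block of
link `e` replaced by the real coordinates `(Re X_ab, Im X_ab)` of `X ∈ M_2(ℂ)`.
[cite: ShenZhuZhu2022, §3 Lemma 3.1 and (1.6)] -/
theorem carre_eq_two_mul_sum_Gam (L : ℕ) [NeZero L] (β' : ℝ) (f : (Edge 3 L × Fin 2 × Fin 2 × Bool → ℝ) → ℝ)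
    (hf : Differentiable ℝ f) (V : GaugeConfig 3 L (Matrix.specialUnitaryGroup (Fin 2) ℂ)) :
    let coords : GaugeConfig 3 L (Matrix.specialUnitaryGroup (Fin 2) ℂ) → (Edge 3 L × Fin 2 × Fin 2 × Bool → ℝ) :=
      fun V q => (fun z : ℂ => if q.2.2.2 then z.im else z.re)
        ((fundamentalRep (Fin 2) (V q.1) : Matrix (Fin 2) (Fin 2) ℂ) q.2.1 q.2.2.1)
    let A : GaugeConfig 3 L (Matrix.specialUnitaryGroup (Fin 2) ℂ) → (Edge 3 L × Fin 2 × Fin 2 × Bool) →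
        (Edge 3 L × Fin 2 × Fin 2 × Bool) → ℝ := fun V i j =>
      ∑ n : Edge 3 L × NoiseIdx 2,
        (if n.1 = i.1 then (fun z : ℂ => if i.2.2.2 then z.im else z.re)
          ((latticeLangevinDynamics (fundamentalLatticeRep 2) β').noise
            (matrixConfig (fundamentalRep (Fin 2)) V) i.1 n.2 i.2.1 i.2.2.1) else 0) *
        (if n.1 = j.1 then (fun z : ℂ => if j.2.2.2 then z.im else z.re)
          ((latticeLangevinDynamics (fundamentalLatticeRep 2) β').noise
            (matrixConfig (fundamentalRep (Fin 2)) V) j.1 n.2 j.2.1 j.2.2.1) else 0)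
    let ψ : Edge 3 L → Matrix (Fin (fundamentalLatticeRep 2).N) (Fin (fundamentalLatticeRep 2).N) ℂ → (Edge 3 L × Fin 2 × Fin 2 × Bool → ℝ) :=
      fun e X q => if q.1 = e then (fun z : ℂ => if q.2.2.2 then z.im else z.re) (X q.2.1 q.2.2.1) else coords V q
    ∑ i : Edge 3 L × Fin 2 × Fin 2 × Bool, ∑ j : Edge 3 L × Fin 2 × Fin 2 × Bool,
        fderiv ℝ f (coords V) (Pi.single i 1) * fderiv ℝ f (coords V) (Pi.single j 1) * A V i j =
      2 * ∑ e : Edge 3 L, SUNBakryEmery.Gam (f ∘ ψ e) (f ∘ ψ e)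
        ((matrixConfig (fundamentalRep (Fin 2)) V : MatrixConfig 3 L (fundamentalLatticeRep 2).N) e) := by
  intro coords A ψ
  classical
  set c : Edge 3 L × Fin 2 × Fin 2 × Bool → ℝ := coords V with hc
  set Q : MatrixConfig 3 L (fundamentalLatticeRep 2).N := matrixConfig (fundamentalRep (Fin 2)) V with hQdef
  have hQe : ∀ e, Q e = (fundamentalRep (Fin 2) (V e) : Matrix (Fin 2) (Fin 2) ℂ) := fun e => rfl
  -- the real coordinate functionals `coordOf q X = Re/Im X_{ab}` and the coordinate vectors of the noise
  set coordOf : (Fin 2 × Fin 2 × Bool) → Matrix (Fin (fundamentalLatticeRep 2).N) (Fin (fundamentalLatticeRep 2).N) ℂ → ℝ := fun p X =>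
    (fun z : ℂ => if p.2.2 then z.im else z.re) (X p.1 p.2.1) with hcoordOf
  set σ : (Edge 3 L × Fin 2 × Fin 2 × Bool) → (Edge 3 L × NoiseIdx 2) → ℝ := fun i n =>
    if n.1 = i.1 then coordOf i.2 ((latticeLangevinDynamics (fundamentalLatticeRep 2) β').noise Q i.1 n.2) else 0 with hσ
  have hA : ∀ i j, A V i j = ∑ n, σ i n * σ j n := fun i j => rfl
  -- §1: `Γ = Σ_n (df[σ_n])²`
  set D : (Edge 3 L × Fin 2 × Fin 2 × Bool → ℝ) →L[ℝ] ℝ := fderiv ℝ f c with hD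
  have h1 : ∑ i, ∑ j, D (Pi.single i 1) * D (Pi.single j 1) * A V i j = ∑ n, (D (fun i => σ i n)) ^ 2 := by
    simp_rw [hA]
    rw [sum_sum_mul_mul_noiseCov_eq_sum_sq (fun i => D (Pi.single i 1)) σ]
    exact sum_congr rfl fun n _ => by rw [sum_apply_single_mul_eq_apply]
  -- the real-coordinate embedding of link `e`: `T e X = (q ↦ [q.1 = e] coordOf q.2 X)`, a continuous linear map
  have hcoord_add : ∀ p (X Y : Matrix (Fin (fundamentalLatticeRep 2).N) (Fin (fundamentalLatticeRep 2).N) ℂ), coordOf p (X + Y) = coordOf p X + coordOf p Y := by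
    intro p X Y; simp only [hcoordOf, Matrix.add_apply]; split_ifs <;> simp
  have hcoord_smul : ∀ p (r : ℝ) (X : Matrix (Fin (fundamentalLatticeRep 2).N) (Fin (fundamentalLatticeRep 2).N) ℂ), coordOf p (r • X) = r * coordOf p X := by
    intro p r X; simp only [hcoordOf, Matrix.smul_apply, Complex.real_smul]
    split_ifs <;> simp [Complex.mul_re, Complex.mul_im]
  let Tl : Edge 3 L → Matrix (Fin (fundamentalLatticeRep 2).N) (Fin (fundamentalLatticeRep 2).N) ℂ →ₗ[ℝ] (Edge 3 L × Fin 2 × Fin 2 × Bool → ℝ) := fun e =>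
    { toFun := fun X q => if q.1 = e then coordOf q.2 X else 0
      map_add' := fun X Y => by
        funext q; simp only [Pi.add_apply]; split_ifs with h
        · exact hcoord_add _ _ _
        · simp
      map_smul' := fun r X => by
        funext q; simp only [Pi.smul_apply, smul_eq_mul, RingHom.id_apply]; split_ifs with h
        · exact hcoord_smul _ _ _
        · simp }
  let T : Edge 3 L → Matrix (Fin (fundamentalLatticeRep 2).N) (Fin (fundamentalLatticeRep 2).N) ℂ →L[ℝ] (Edge 3 L × Fin 2 × Fin 2 × Bool → ℝ) := fun e =>
    LinearMap.toContinuousLinearMap (Tl e)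
  have hT : ∀ e X q, T e X q = if q.1 = e then coordOf q.2 X else 0 := fun e X q => rfl
  -- `ψ e` is affine: `ψ e X = T e X + (c − T e (Q e))`
  have hψ : ∀ e X, ψ e X = T e X + (c - T e (Q e)) := by
    intro e X
    funext q
    simp only [Pi.add_apply, Pi.sub_apply, hT]
    by_cases h : q.1 = e
    · simp only [ψ, h, if_true]
      have : c q = coordOf q.2 (Q e) := by
        simp only [hc, coords, hcoordOf, hQe, ← h]
      rw [this]; ring
    · simp only [ψ, h, if_false, hc]; ring
  have hψQ : ∀ e, ψ e (Q e) = c := by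
    intro e; rw [hψ]; abel
  -- chain rule: `d(f∘ψ_e)(Q_e)[H] = df(c)[T e H]`
  have hchain : ∀ e (H : Matrix (Fin (fundamentalLatticeRep 2).N) (Fin (fundamentalLatticeRep 2).N) ℂ), fderiv ℝ (f ∘ ψ e) (Q e) H = D (T e H) := by
    intro e H
    have hψd : HasFDerivAt (ψ e) (T e) (Q e) := by
      have : ψ e = fun X => T e X + (c - T e (Q e)) := funext (hψ e)
      rw [this]
      exact (T e).hasFDerivAt.add_const _
    have hfd : HasFDerivAt f D (ψ e (Q e)) := by rw [hψQ]; exact (hf c).hasFDerivAt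
    have hcomp : HasFDerivAt (f ∘ ψ e) (D.comp (T e)) (Q e) := hfd.comp (Q e) hψd
    have e1 : fderiv ℝ (f ∘ ψ e) (Q e) = D.comp (T e) := hcomp.fderiv
    rw [e1, ContinuousLinearMap.comp_apply]
  -- the noise coordinate vector of `(e, m)` is `T e (noise Q e m)`
  have hσT : ∀ (e : Edge 3 L) (m : NoiseIdx 2), (fun i => σ i (e, m)) =
      T e ((latticeLangevinDynamics (fundamentalLatticeRep 2) β').noise Q e m) := by
    intro e m; funext i
    rw [hT]
    simp only [hσ]
    by_cases h : i.1 = e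
    · rw [if_pos h.symm, if_pos h, h]
    · rw [if_neg (Ne.symm h), if_neg h]
  -- assemble link by link
  have hQunit : ∀ e, Q e * (Q e)ᴴ = 1 ∧ (Q e)ᴴ * Q e = 1 := by
    intro e
    have hU : Q e ∈ Matrix.unitaryGroup (Fin 2) ℂ := by rw [hQe]; exact (V e).2.1
    exact ⟨Matrix.mem_unitaryGroup_iff.1 hU, Matrix.mem_unitaryGroup_iff'.1 hU⟩
  calc ∑ i, ∑ j, D (Pi.single i 1) * D (Pi.single j 1) * A V i j
      = ∑ n : Edge 3 L × NoiseIdx 2, (D (fun i => σ i n)) ^ 2 := h1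
    _ = ∑ e : Edge 3 L, ∑ m : NoiseIdx 2, (D (fun i => σ i (e, m))) ^ 2 := Fintype.sum_prod_type _
    _ = ∑ e : Edge 3 L, ∑ m : NoiseIdx 2,
          (fderiv ℝ (f ∘ ψ e) (Q e) ((Real.sqrt 2 : ℂ) • ((fundamentalLatticeRep 2).lieProj (noiseDir m) * Q e))) ^ 2 := by
        refine sum_congr rfl fun e _ => sum_congr rfl fun m _ => ?_
        rw [hσT, ← hchain, latticeLangevinDynamics_noise]
    _ = ∑ e : Edge 3 L, 2 * ∑ α : SUNBakryEmery.FrameIdx (fundamentalLatticeRep 2).N,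
          (fderiv ℝ (f ∘ ψ e) (Q e) (Q e * SUNBakryEmery.frame α)) ^ 2 := by
        refine sum_congr rfl fun e _ => ?_
        have h := sum_sq_apply_noise_eq_two_mul_sum_sq_apply_mul_frame ((fderiv ℝ (f ∘ ψ e) (Q e)).toLinearMap)
          (hQunit e).1 (hQunit e).2
        simp only [ContinuousLinearMap.coe_coe] at h
        exact h
    _ = 2 * ∑ e : Edge 3 L, SUNBakryEmery.Gam (f ∘ ψ e) (f ∘ ψ e)
          ((matrixConfig (fundamentalRep (Fin 2)) V : MatrixConfig 3 L (fundamentalLatticeRep 2).N) e) := by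
        rw [mul_sum]
        refine sum_congr rfl fun e _ => ?_
        congr 1
        simp only [SUNBakryEmery.Gam, SUNBakryEmery.matD_apply, sq]
        rfl

end Summit.QuantumFields.YangMills.Theorems.ColdStartUniversality

end
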